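import Summits.BirchSwinnertonDyer.BirchSwinnertonDyer.Theorems.ManinLocalTwoThreeEtaIdentitiesTwenty
import Summits.BirchSwinnertonDyer.Rank1Residual.Additive.IntModelConductorCertificate
import Summits.BirchSwinnertonDyer.BirchSwinnertonDyer.Theorems.ByReductionTypeAtTwoAdditivePotGoodPrintShuZhai20a1Base
import HarnessLib

/-!
# Level 20: `N([−2, 0, −4, 0, 0]) = N(20a1) = 20` in the kernel; the `X₀(20)`-domain of C2 is inhabited
# under the item's own modularity binder, and every datum there has `|c| = 1` (fact-free)

Cell bsd-f2-manin, route `ManinLocalTwoThree` (crux C2 `ManinOddAtFour` stmt-22967: `2² ∣ 20`), prover seat p3 gen 23;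
the level-`20` twin of p2 g26's `…NeronSqueezeTwentyFour` §1/§3 and of `…NonVacuityThirtySix` (there CM made
§3 unconditional; at `20` there is no CM and a fact-free `aₙ(φ₂₀) = aₙ(20a1)` is NOT claimed).

* §1 The `η`-model `W₀ = [−2, 0, −4, 0, 0]` of `EtaIdentitiesTwenty` (`y² − 2xy − 4y = x³`, `Δ = −6400 = −2⁸5²`,
  `c₄ = −176`, `c₆ = −2368`) IS Cremona's `20a1 = [0, 1, 0, 4, 4]` up to the integral change `(u, r, s, t) = (1, 0, 1, 2)`;
  **`N(W₀) = N(20a1) = 20`** by the rank-2 observatory's kernel Tate certificates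
  (`IntModelCond.conductorNorm_mk_eq_of_certs_of_eq`, NO named fact; completes `AddPotGoodPrint.conductorNorm_dvd_20a1` of the
  Shu–Zhai print file, whose `isElliptic_20a1` / `isGloballyMinimal_20a1` are reused here): at `2` the deep exit `IV*` is read on `W₀` itself
  (`2 ∣ a₁`, `4 ∣ a₂, a₃` with `a₃/4 = −1` odd, `8 ∣ a₄`, `16 ∣ a₆`), `f₂ = v₂(Δ) + 1 − 7 = 2`; `3` is good; `5` is
  non-split multiplicative (`5 ∤ c₄`, nodal discriminant `≡ 2 (mod 5)` a non-residue), `f₅ = 1`.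
* §2 GIVEN THE ITEM'S OWN BINDER `exists_isNewformOf` (modularity, Diamond–Shurman Thm. 8.8.3): `W₀` has a newform in
  `S₂(Γ₀(20))`; it is `φ₂₀ = η(2τ)²η(10τ)²` (`LevelTwenty.eq_etaProductTwenty_of_isNewform0`), so `aₙ(φ₂₀) = aₙ(20a1)` for
  all `n`; a lattice-optimal `X₀(20)`-datum on a globally minimal curve of the class `20a` exists (Literature's datum
  package + the unconditional EXO `existsMinimalOptimalDatum_full`) — C2's `∀`-domain at `N = 20` is inhabited relative to
  the item's hypotheses — and (fact-free, `EtaIdentitiesTwenty`) EVERY such datum has `|c| = 1`, `2 ∤ c`.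

HONEST FRAMING: §1 unconditional (kernel certificates, standard axioms); §2 CONDITIONAL on `exists_isNewformOf` only (one of the
four hypotheses the item `ManinOddAtFour` itself carries; Mazur / Abbes–Ullmo / Česnavičius / CDT are NOT used).  Nothing here
proves C2 (all levels), Manin's conjecture or BSD; items 22967/22968 stay OPEN as filed.  No definition, no named fact, no sorry.
[cite: Silverman1994, IV.9.4 Steps 6–8 and IV.11.1] [cite: SilvermanAEC2009, VII.1 Remark 1.1] [cite: CremonaAlgorithms1997, Table 1 (20a1), Table 3 (N = 20)]
[cite: DiamondShurman2005, Thm. 8.8.3] [cite: EdixhovenManin1991, Prop. 2]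
-/

set_option autoImplicit false
-- lint-debt: the directory name repeats the summit name (sibling precedent `ManinLocalTwoThreeNeronSqueezeTwentyFour.lean`)
set_option linter.dupNamespace false

noncomputable section

open Complex Filter Topology Set Function
open UpperHalfPlane hiding I
open scoped Real Topology Manifold MatrixGroups ModularForm
open ModularForm CongruenceSubgroup WeierstrassCurve
open Summit.BirchSwinnertonDyer.BirchSwinnertonDyer.Rank2Observatory
open Summit.BirchSwinnertonDyer.BirchSwinnertonDyer.Rank2Observatory.RootNumber
open Summit.BirchSwinnertonDyer.BirchSwinnertonDyer.Rank2Observatory.Tate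
open Summit.BirchSwinnertonDyer.Rank1Residual.Additive
open Literature.NumberTheory.EllipticCurves Literature.NumberTheory.EllipticCurves.ModularForms
open Literature.NumberTheory.Automorphic

namespace Summit.BirchSwinnertonDyer.BirchSwinnertonDyer.Theorems.ManinLocalTwoThree.NonVacuityTwenty

open LevelTwenty NeronSqueezeTwenty EtaIdentitiesTwenty

/-! ## §1 `W₀ = [−2, 0, −4, 0, 0] ≅ 20a1`: conductor `20` in the kernel -/

/-- The literal `ℚ`-model `[−2, 0, −4, 0, 0]` read through integer casts. [folklore] -/
theorem mk_W20_eq_cast :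
    (⟨-2, 0, -4, 0, 0⟩ : WeierstrassCurve ℚ) = ⟨((-2 : ℤ) : ℚ), ((0 : ℤ) : ℚ), ((-4 : ℤ) : ℚ), ((0 : ℤ) : ℚ), ((0 : ℤ) : ℚ)⟩ := by
  ext <;> norm_num

/-- The literal `ℚ`-model `20a1 = [0, 1, 0, 4, 4]` read through integer casts. [folklore] -/
theorem mk_twentyA1_eq_cast :
    (⟨0, 1, 0, 4, 4⟩ : WeierstrassCurve ℚ) = ⟨((0 : ℤ) : ℚ), ((1 : ℤ) : ℚ), ((0 : ℤ) : ℚ), ((4 : ℤ) : ℚ), ((4 : ℤ) : ℚ)⟩ := by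
  ext <;> norm_num

/-- **The `η`-model is Cremona's `20a1`**: `(1, 0, 1, 2) • [−2, 0, −4, 0, 0] = [0, 1, 0, 4, 4]` (an integral change of
variables with `u = 1`, so both are globally minimal models of the same curve). [cite: CremonaAlgorithms1997, Table 1 (20a1)] -/
theorem variableChange_W20_eq_twentyA1 :
    (⟨1, 0, 1, 2⟩ : VariableChange ℚ) • (⟨-2, 0, -4, 0, 0⟩ : WeierstrassCurve ℚ) = ⟨0, 1, 0, 4, 4⟩ := by
  ext <;> simp [variableChange_a₁, variableChange_a₂, variableChange_a₃, variableChange_a₄, variableChange_a₆] <;> norm_num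

/-- **`N([−2, 0, −4, 0, 0]) = 20 = 2²·5`**: deep Tate certificate at `2` read on the model itself (`(r, s, t) = (0, 0, 0)`, exit `IV*`:
`2 ∣ a₁ = −2`, `4 ∣ a₂ = 0`, `4 ∣ a₃ = −4` with `(a₃/4)² + 4(a₆/16) = 1` odd, `8 ∣ a₄ = 0`, `16 ∣ a₆ = 0`; `f₂ = 8 + 1 − 7 = 2`); good at
`3`; non-split multiplicative at `5` (`f₅ = 1`); minimality certificate `v₂(Δ) = 8 < 12`, `5 ∤ c₄`.  NO named fact.
[cite: Silverman1994, IV.9.4 Step 8 and IV.11.1] [cite: CremonaAlgorithms1997, Table 1 (20a1)] -/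
theorem conductorNorm_W20 : (⟨-2, 0, -4, 0, 0⟩ : WeierstrassCurve ℚ).conductorNorm ℤ = 20 := by
  rw [mk_W20_eq_cast]
  exact IntModelCond.conductorNorm_mk_eq_of_certs_of_eq (-2) 0 (-4) 0 0
    (cm := ⟨8, 4, 6, [⟨5, 2, 2, 0, 0⟩]⟩) (c := ⟨8, 4, 6, 0, 0, 0, [⟨5, 2, 2, 0, 0⟩]⟩)
    (l₂ := ⟨3, 0, 0, 0, 8, 8, 0⟩) (l₃ := ⟨0, 0, 0, 0, 0, 0, 0⟩)
    (by decide +kernel) (by decide +kernel) (by decide +kernel) (by decide +kernel) (by decide +kernel)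

/-- **`N(20a1) = N([0, 1, 0, 4, 4]) = 20`** on Cremona's literal model: deep Tate certificate at `2` with the change
`(r, s, t) = (0, −1, −2)` back to `[−2, 0, −4, 0, 0]`, exit `IV*`, `f₂ = 2`; good at `3`; non-split multiplicative at `5`.
NO named fact. [cite: Silverman1994, IV.9.4 Step 8 and IV.11.1] [cite: CremonaAlgorithms1997, Table 1 (20a1)] -/
theorem conductorNorm_twentyA1 : (⟨0, 1, 0, 4, 4⟩ : WeierstrassCurve ℚ).conductorNorm ℤ = 20 := by
  rw [mk_twentyA1_eq_cast]
  exact IntModelCond.conductorNorm_mk_eq_of_certs_of_eq 0 1 0 4 4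
    (cm := ⟨8, 4, 6, [⟨5, 2, 2, 0, 0⟩]⟩) (c := ⟨8, 4, 6, 0, 0, 0, [⟨5, 2, 2, 0, 0⟩]⟩)
    (l₂ := ⟨3, 0, -1, -2, 8, 8, 0⟩) (l₃ := ⟨0, 0, 0, 0, 0, 0, 0⟩)
    (by decide +kernel) (by decide +kernel) (by decide +kernel) (by decide +kernel) (by decide +kernel)

/-- `2² ∣ 20`: the level `20` lies in C2's `4 ∣ N` world. [folklore] -/
theorem two_sq_dvd_twenty : 2 ^ 2 ∣ 20 := ⟨5, by norm_num⟩

/-! ## §2 C2's `∀`-domain at `N = 20` is inhabited, GIVEN the item's own binder `exists_isNewformOf` -/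

/-- **Modularity at `[−2, 0, −4, 0, 0] ≅ 20a1`, levelled**: under `exists_isNewformOf` the curve has a newform in `S₂(Γ₀(20))`
(its conductor IS `20`, §1).  CONDITIONAL on modularity. [cite: DiamondShurman2005, Thm. 8.8.3] -/
theorem exists_isNewformOf_W20 (hnf : exists_isNewformOf) :
    ∃ f : CuspForm (Gamma0 20) 2, IsNewformOf (⟨-2, 0, -4, 0, 0⟩ : WeierstrassCurve ℚ) f := by
  haveI := isElliptic_W20
  have key : ∀ (N : ℕ) [NeZero N], (⟨-2, 0, -4, 0, 0⟩ : WeierstrassCurve ℚ).conductorNorm ℤ = N →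
      ∃ f : CuspForm (Gamma0 N) 2, IsNewformOf (⟨-2, 0, -4, 0, 0⟩ : WeierstrassCurve ℚ) f := by
    intro N _ hN
    subst hN
    exact hnf _
  haveI : NeZero (20 : ℕ) := ⟨by decide⟩
  exact key 20 conductorNorm_W20

/-- **Modularity at Cremona's literal `20a1 = [0, 1, 0, 4, 4]`, levelled.**  CONDITIONAL on `exists_isNewformOf`.
[cite: DiamondShurman2005, Thm. 8.8.3] -/
theorem exists_isNewformOf_twentyA1 (hnf : exists_isNewformOf) :
    ∃ f : CuspForm (Gamma0 20) 2, IsNewformOf (⟨0, 1, 0, 4, 4⟩ : WeierstrassCurve ℚ) f := by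
  haveI := AddPotGoodPrint.isElliptic_20a1
  have key : ∀ (N : ℕ) [NeZero N], (⟨0, 1, 0, 4, 4⟩ : WeierstrassCurve ℚ).conductorNorm ℤ = N →
      ∃ f : CuspForm (Gamma0 N) 2, IsNewformOf (⟨0, 1, 0, 4, 4⟩ : WeierstrassCurve ℚ) f := by
    intro N _ hN
    subst hN
    exact hnf _
  haveI : NeZero (20 : ℕ) := ⟨by decide⟩
  exact key 20 conductorNorm_twentyA1

/-- Under modularity the newform of `20a1` IS `φ₂₀ = η(2τ)²η(10τ)²`: `aₙ(φ₂₀) = aₙ([−2, 0, −4, 0, 0])` for all `n`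
(`LevelTwenty.eq_etaProductTwenty_of_isNewform0`: the only newform of level `20`).  CONDITIONAL on `exists_isNewformOf`
(no CM at `20`: a fact-free proof is not claimed). [cite: CremonaAlgorithms1997, Table 3 (N = 20)] -/
theorem cuspCoeff_etaProductTwenty_eq_lFunction_W20_of_modularity (hnf : exists_isNewformOf) (n : ℕ) :
    cuspCoeff cuspFormEtaProductTwenty n = ((⟨-2, 0, -4, 0, 0⟩ : WeierstrassCurve ℚ).LFunction n : ℂ) := by
  obtain ⟨f, hf⟩ := exists_isNewformOf_W20 hnf
  rw [← eq_etaProductTwenty_of_isNewform0 hf.1]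
  exact hf.2 n

/-- The same on Cremona's literal model: `aₙ(φ₂₀) = aₙ(20a1)` for all `n`, CONDITIONAL on `exists_isNewformOf`.
[cite: CremonaAlgorithms1997, Table 3 (N = 20)] -/
theorem cuspCoeff_etaProductTwenty_eq_lFunction_twentyA1_of_modularity (hnf : exists_isNewformOf) (n : ℕ) :
    cuspCoeff cuspFormEtaProductTwenty n = ((⟨0, 1, 0, 4, 4⟩ : WeierstrassCurve ℚ).LFunction n : ℂ) := by
  obtain ⟨f, hf⟩ := exists_isNewformOf_twentyA1 hnf
  rw [← eq_etaProductTwenty_of_isNewform0 hf.1]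
  exact hf.2 n

/-- **A lattice-optimal `X₀(20)`-datum on a globally minimal curve of the class `20a` exists under modularity** (Literature's
datum package `nonempty_modularParametrizationData_of_isNewformOf` + the unconditional EXO `existsMinimalOptimalDatum_full`),
i.e. C2's `∀`-domain at `N = 20` is inhabited relative to the item's hypotheses.  CONDITIONAL on `exists_isNewformOf` only.
[cite: EdixhovenManin1991, Prop. 2] [cite: DiamondShurman2005, Thm. 8.8.3] -/
theorem maninOddAtFour_domain_inhabited_twenty_of_modularity (hnf : exists_isNewformOf) :
    ∃ (W₀ : WeierstrassCurve ℚ) (_ : W₀.IsElliptic) (_ : W₀.IsGloballyMinimal) (D₀ : ModularParametrizationData W₀ 20),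
      (⟨0, 1, 0, 4, 4⟩ : WeierstrassCurve ℚ).IsIsogenous W₀ ∧ (∀ z ∈ D₀.L.lattice, ∃ w ∈ periodLattice D₀.f, z = D₀.c * w) ∧
        2 ^ 2 ∣ 20 := by
  haveI := AddPotGoodPrint.isElliptic_20a1
  haveI : NeZero (20 : ℕ) := ⟨by decide⟩
  obtain ⟨f, hf⟩ := exists_isNewformOf_twentyA1 hnf
  obtain ⟨D⟩ := nonempty_modularParametrizationData_of_isNewformOf hf
  obtain ⟨W₀, h₀, hmin, D₀, -, hiso, hopt, -⟩ :=
    ExistsMinimalOptimalDatum.existsMinimalOptimalDatum_full (⟨0, 1, 0, 4, 4⟩ : WeierstrassCurve ℚ) D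
  exact ⟨W₀, h₀, hmin, D₀, hiso, hopt, two_sq_dvd_twenty⟩

/-- **C2 at `N = 20` is NON-VACUOUSLY TRUE under the item's modularity binder alone**: there IS a globally minimal elliptic
`W₀/ℚ` with a lattice-optimal `X₀(20)`-datum (conditional on `exists_isNewformOf`), and EVERY `X₀(20)`-datum with the lattice
clause of EVERY globally minimal elliptic `W/ℚ` has `|c| = 1` and `2 ∤ c` (fact-free, `EtaIdentitiesTwenty`).  Mazur, Abbes–Ullmo,
Česnavičius and CDT are not used. [cite: EdixhovenManin1991, Prop. 2] [cite: AgasheRibetStein2006, §§1–2] -/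
theorem maninOddAtFour_twenty_nonvacuous_of_modularity (hnf : exists_isNewformOf) :
    (∃ (W₀ : WeierstrassCurve ℚ) (_ : W₀.IsElliptic) (_ : W₀.IsGloballyMinimal) (D₀ : ModularParametrizationData W₀ 20),
        (∀ z ∈ D₀.L.lattice, ∃ w ∈ periodLattice D₀.f, z = D₀.c * w) ∧ |D₀.maninConstant| = 1) ∧
      ∀ (W : WeierstrassCurve ℚ) [W.IsElliptic] [W.IsGloballyMinimal] (D : ModularParametrizationData W 20),
        (∀ z ∈ D.L.lattice, ∃ w ∈ periodLattice D.f, z = D.c * w) → 2 ^ 2 ∣ 20 → ¬ (2 : ℤ) ∣ D.maninConstant := by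
  refine ⟨?_, fun W _ _ D hopt _ ↦ not_two_dvd_maninConstant_twenty W D hopt⟩
  obtain ⟨W₀, h₀, hmin, D₀, -, hopt, -⟩ := maninOddAtFour_domain_inhabited_twenty_of_modularity hnf
  haveI := h₀
  haveI := hmin
  exact ⟨W₀, h₀, hmin, D₀, hopt, abs_maninConstant_eq_one_twenty W₀ D₀ hopt⟩

end Summit.BirchSwinnertonDyer.BirchSwinnertonDyer.Theorems.ManinLocalTwoThree.NonVacuityTwenty

end
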